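import Literature.Topology.PlaneTopology.Crosscut
import HarnessLib

/-!
# Crux `BoundaryClosureR` (stmt-CriticalPhenomena-14004), line `polygon-parity-squeeze`,
# stub `stub_innerPolygons` (IP): marking a Jordan domain at two prescribed boundary points

Landing target:
`Summits/CriticalPhenomena/SAWScalingLimit/Theorems/SAWDefectDecoherenceBoundaryClosureRInnerPolygonsMarks.lean`
(`--supports stmt-CriticalPhenomena-14004`; building block of the registered stub `stub_innerPolygons`).

The inner polygon `P` of the squeeze is produced as a Jordan domain (`polygonDomain` of the boundary
cycle) and must then be MARKED at the two prescribed points `pt 0 = D.pt 0` (root) and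
`pt 1 = D.pt 1` (normaliser), both on its frontier.  `MarkedDomain` asks for increasing mark
parameters in `[0, 1)`, so the loop is re-based at the parameter of the first point (as in
`MarkedDomain.swap` of `ChordalReversibility.lean`):

* `markTwo J s t` (data) — the Dobrushin domain with the carrier of `J`, boundary loop
  `u ↦ ∂J (u + s)` and marks `0`, `t - s` (`s < t < s + 1`); `markTwo_pt_zero/one`: its marked points
  are `∂J s`, `∂J t`;
* `exists_dobrushinDomain_of_frontier_points` — **any two distinct frontier points of a Jordan domain
  are the marked points of a Dobrushin domain with the same carrier and the same boundary curve.**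

Sources: W. Werner, *Lectures on two-dimensional critical percolation* (2007) §2 (domains with marked
points); folklore.  No proposition is defined and no named fact is introduced.
-/

noncomputable section

open Set
open Literature.Probability.RandomPlanarGeometry

namespace Summit.CriticalPhenomena.SAWScalingLimit.Theorems.PolygonParitySqueeze

/-- **Marking a Jordan domain at the parameters `s < t < s + 1`** (data): same carrier, boundary loop
re-based at `s`, marks `0` and `t - s`. [folklore] -/
def markTwo (J : JordanDomain) (s t : ℝ) (hst : s < t) (hts : t < s + 1) : DobrushinDomain where
  carrier := J.carrier
  boundary u := J.boundary (u + s)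
  isOpen := J.isOpen
  isBounded := J.isBounded
  isConnected := J.isConnected
  continuous_boundary := J.continuous_boundary.comp (continuous_id.add continuous_const)
  periodic_boundary := J.periodic_boundary.add_const _
  injOn_boundary u hu v hv huv :=
    add_right_cancel (J.injOn_boundary_Ico s
      (show u + s ∈ Ico s (s + 1) from ⟨by linarith [hu.1], by linarith [hu.2]⟩)
      (show v + s ∈ Ico s (s + 1) from ⟨by linarith [hv.1], by linarith [hv.2]⟩)
      (show J.boundary (u + s) = J.boundary (v + s) from huv))
  range_boundary := by
    rw [show (fun u => J.boundary (u + s)) = J.boundary ∘ fun u => u + s from rfl,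
      (add_right_surjective _).range_comp]
    exact J.range_boundary
  mark := ![0, t - s]
  strictMono_mark := by
    refine Fin.strictMono_iff_lt_succ.2 fun k => ?_
    fin_cases k
    simp only [Fin.zero_eta, Fin.castSucc_zero, Matrix.cons_val_zero, Fin.succ_zero_eq_one,
      Matrix.cons_val_one]
    linarith
  mark_mem k := by
    fin_cases k
    · simp
    · simp only [Fin.mk_one, Matrix.cons_val_one, Matrix.cons_val_zero, mem_Ico]
      exact ⟨by linarith, by linarith⟩

/-- The carrier of the marked domain is that of `J`. [folklore] -/
@[simp] theorem markTwo_carrier (J : JordanDomain) (s t : ℝ) (hst : s < t) (hts : t < s + 1) :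
    (markTwo J s t hst hts).carrier = J.carrier := rfl

/-- The boundary curve (as a set) of the marked domain is that of `J`. [folklore] -/
theorem range_markTwo_boundary (J : JordanDomain) (s t : ℝ) (hst : s < t) (hts : t < s + 1) :
    range (markTwo J s t hst hts).boundary = range J.boundary := by
  rw [(markTwo J s t hst hts).range_boundary, J.range_boundary]
  rfl

/-- The first marked point is `∂J s`. [folklore] -/
theorem markTwo_pt_zero (J : JordanDomain) (s t : ℝ) (hst : s < t) (hts : t < s + 1) :
    (markTwo J s t hst hts).pt 0 = J.boundary s := by
  show J.boundary ((![0, t - s] : Fin 2 → ℝ) 0 + s) = J.boundary s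
  simp

/-- The second marked point is `∂J t`. [folklore] -/
theorem markTwo_pt_one (J : JordanDomain) (s t : ℝ) (hst : s < t) (hts : t < s + 1) :
    (markTwo J s t hst hts).pt 1 = J.boundary t := by
  show J.boundary ((![0, t - s] : Fin 2 → ℝ) 1 + s) = J.boundary t
  simp

/-- **Two distinct frontier points of a Jordan domain are the marked points of a Dobrushin domain
with the same carrier and the same boundary curve** (sub-goal of `stub_innerPolygons`: marking the
inner polygon at the root and at the normaliser). [cite: Werner2007, §2 (domains with marked boundary points)] -/
theorem exists_dobrushinDomain_of_frontier_points : ∀ (J : JordanDomain) (p q : ℂ), p ∈ frontier J.carrier → q ∈ frontier J.carrier → p ≠ q → ∃ D : DobrushinDomain, D.carrier = J.carrier ∧ D.pt 0 = p ∧ D.pt 1 = q ∧ Set.range D.boundary = Set.range J.boundary := by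
  intro J p q hp hq hpq
  rw [J.frontier_eq_image_Ico] at hp hq
  obtain ⟨s, hs, rfl⟩ := hp
  obtain ⟨t, ht, rfl⟩ := hq
  have hst : s ≠ t := fun h => hpq (by rw [h])
  rcases lt_or_gt_of_ne hst with h | h
  · exact ⟨markTwo J s t h (by linarith [hs.1, ht.2]), rfl, markTwo_pt_zero _ _ _ _ _,
      markTwo_pt_one _ _ _ _ _, range_markTwo_boundary _ _ _ _ _⟩
  · refine ⟨markTwo J s (t + 1) (by linarith [hs.2, ht.1]) (by linarith), rfl,
      markTwo_pt_zero _ _ _ _ _, ?_, range_markTwo_boundary _ _ _ _ _⟩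
    rw [markTwo_pt_one, J.periodic_boundary]

end Summit.CriticalPhenomena.SAWScalingLimit.Theorems.PolygonParitySqueeze

end
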